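import Summits.CriticalPhenomena.PercolationContinuityZ3.Theorems.PercLowPointHalfSpaceBoundaryTwoArmDecayStubStep
import Summits.CriticalPhenomena.PercolationContinuityZ3.Theorems.PercLowPointHalfSpaceBoundaryTwoArmDecayStubCensus
import Summits.CriticalPhenomena.PercolationContinuityZ3.Theorems.PercLowPointHalfSpaceBoundaryTwoArmDecayStubTallDensity
import Summits.CriticalPhenomena.PercolationContinuityZ3.Theorems.PercLowPointHalfSpaceBoundaryTwoArmDecayStubReach

/-!
# Crux `PercLowPointHalfSpace.BoundaryTwoArmDecay` (stmt-CriticalPhenomena-0911), line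
# `staircase-bootstrap-floor-decoupling` (reshaped by lead c1): the DIRECT STEP and the CONDITIONAL REDUCTION TO KTAIL

Proves EXACTLY two registered sub-goals of the crux item, both `--supports stmt-CriticalPhenomena-0911`:

* `stub_directStep` (registered stub of the skeleton `Cruxes/BoundaryTwoArmDecay/Lines/staircase_bootstrap_floor_decoupling.lean`):

    `SubpolynomialBlocking → KTail → ∀ σ > 0, AprioriV (3 - σ)`;

* `stub_kTailReduction` (the skeleton's composition `BoundaryTwoArmDecay_of`, replayed against the landed theorems):

    `KTail → (SlabCrossover A for some A ∈ [1, 6/5)) → SubpolynomialBlocking → BoundaryTwoArmDecay`,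

where, with `A_n = kissV n 0 1` (both `ℍ`-clusters of the adjacent floor roots `0, e` meet level `n` and are
distinct), `K_n = (partnerKiss n ω).ncard` (partner-kiss floor edges of `U = C_ℍ(0)`: floor edges `q₁q₂` with
`q₁ ∈ U ∌ q₂` and `C_ℍ(q₂)` n-tall) and `e_n = E[1{height U = n}/|U ∩ ∂ℍ|]` (`StubStep.exactDens`):

* `KTail` (the ONE new conjecture of the reshaped line, a HYPOTHESIS here — "subpolynomial partner-kiss multiplicity
  in probability"): `∀ s > 0`, eventually `n^{-s} P(A_n) ≤ P(A_n ∧ K_n ≤ ⌈n^s⌉)`;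
* `AprioriV a`: `∃ C, ∀ n ≥ 1, P(A_n) ≤ C n^{-a}`;
* `SlabCrossover A`: the body of stmt-CriticalPhenomena-6700 `SlabCrossoverPolynomial` at a given exponent `A` (here capped
  below `6/5`: the registered stub `stub_slab`);
* `SubpolynomialBlocking`: the tagged sibling crux stmt-CriticalPhenomena-4446, by name.

So crux A of route `PercLowPointHalfSpace` is now CONDITIONAL on {KTail, 6700⁺, 4446} and on nothing else; the previous
reduction (`stub_staircaseReduction`, p132327) needed the PAIR of new conjectures {Q (floor decoupling), Q_conf
(confinement)} in place of KTail, and consumed them only to bound `K_n` on `A_n`.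

## Proof of the direct step (`StubDirectStep.aprioriV_direct`)

With `s = t = σ/3`: for `n ≥ N₀(s)`, KTail and the LANDED truncated census (`stub_census`, p132078:
`P(A_n ∧ K_n ≤ k) ≤ C₁ k e_n`) at `k = ⌈n^s⌉ ≤ 2 n^s` give `P(A_n) ≤ 2 C₁⁺ n^{2s} e_n`.  Since `A_n` is antitone in
`n` (`StubStep.kissV_antitone_level`) and `Σ_{m ∈ [N,2N]} e_m ≤ ν_N ≤ C_t⁺ N^{t-2}` (the LANDED tall density
`stub_tallDensity`, p131461, from `SubpolynomialBlocking`; `StubStep.sum_exactDens_toReal_le`), dyadic averaging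
(`StubStep.even_bound`) gives `P(A_{2N}) ≤ C N^{2s + t - 3} = C N^{-(3 - σ)}` for `N ≥ max N₀ 1`, and
`StubStep.decay_of_eventually` extends the bound to every `n ≥ 1`.  No staircase, no seed, no floor decoupling,
no confinement.

## Proof of the reduction (`stub_kTailReduction`)

With the slab exponent `A ∈ [1, 6/5)` put `σ = (6 - 5A)/16`; the direct step at loss `3σ` gives the vertical exponent
`3 - 3σ`; with `b = 13/4 - 5A/8 > 5/2` one has `b·A < 3 - 3σ ⟺ (6/5 - A)(5/2 - A) > 0`, so the LANDED reach reduction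
(`stub_reach`, p130902) gives `P(E_r) ≤ C r^{-b}`, i.e. the crux with `κ = b - 5/2 > 0` (`Negative.boundaryTwoArmDecay_iff`).
-/

noncomputable section

namespace Summit.CriticalPhenomena.PercolationContinuityZ3.Theorems.BoundaryTwoArmDecay

open MeasureTheory
open scoped ENNReal
open Literature.Probability.Percolation Literature.Probability.LatticeModels

namespace StubDirectStep

open Negative (μ)
open StubStep (kissV partnerKiss exactDens tallDens kissV_antitone_level sum_exactDens_toReal_le even_bound
  decay_of_eventually)

/-- **One value of `n`.** From KTail AT `n` with loss `s ≥ 0` and the census at `k = ⌈n^s⌉`: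
`P(A_n) ≤ 2 C₁⁺ n^{s+s} e_n`. -/
theorem pointwise {C₁ s : ℝ} {n : ℕ} (hn : 1 ≤ n) (hs : 0 ≤ s)
    (hC₁ : ∀ k : ℕ, 1 ≤ k → μ.real (kissV n 0 1 ∩ {ω | (partnerKiss n ω).ncard ≤ k}) ≤
      C₁ * (k : ℝ) * (exactDens n).toReal)
    (hK : (n : ℝ) ^ (-s) * μ.real (kissV n 0 1) ≤
      μ.real (kissV n 0 1 ∩ {ω | (partnerKiss n ω).ncard ≤ ⌈(n : ℝ) ^ s⌉₊})) :
    μ.real (kissV n 0 1) ≤ 2 * max C₁ 0 * (n : ℝ) ^ (s + s) * (exactDens n).toReal := by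
  have hn1 : (1 : ℝ) ≤ n := by exact_mod_cast hn
  have hnpos : (0 : ℝ) < n := by positivity
  set x : ℝ := (n : ℝ) ^ s with hx
  have hx1 : 1 ≤ x := Real.one_le_rpow hn1 hs
  have hx0 : 0 < x := by linarith
  set k : ℕ := ⌈x⌉₊ with hk
  have hk1 : 1 ≤ k := Nat.one_le_ceil_iff.2 hx0
  have hkx : (k : ℝ) ≤ 2 * x := by
    have := Nat.ceil_lt_add_one hx0.le
    rw [← hk] at this
    linarith
  have he0 : 0 ≤ (exactDens n).toReal := ENNReal.toReal_nonneg
  have hP0 : 0 ≤ μ.real (kissV n 0 1) := measureReal_nonneg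
  -- `P ≤ x · P(A_n ∧ K_n ≤ k)`
  have h1 : μ.real (kissV n 0 1) ≤ x * μ.real (kissV n 0 1 ∩ {ω | (partnerKiss n ω).ncard ≤ k}) := by
    have h := mul_le_mul_of_nonneg_left hK hx0.le
    rwa [← mul_assoc, Real.rpow_neg hnpos.le, ← hx, mul_inv_cancel₀ hx0.ne', one_mul] at h
  -- the census at `k`, with `C₁ ≤ C₁⁺` and `k ≤ 2x`
  have h2 : μ.real (kissV n 0 1 ∩ {ω | (partnerKiss n ω).ncard ≤ k}) ≤
      max C₁ 0 * (2 * x) * (exactDens n).toReal :=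
    calc _ ≤ C₁ * (k : ℝ) * (exactDens n).toReal := hC₁ k hk1
      _ ≤ max C₁ 0 * (k : ℝ) * (exactDens n).toReal :=
          mul_le_mul_of_nonneg_right (mul_le_mul_of_nonneg_right (le_max_left _ _) (Nat.cast_nonneg _)) he0
      _ ≤ max C₁ 0 * (2 * x) * (exactDens n).toReal :=
          mul_le_mul_of_nonneg_right (mul_le_mul_of_nonneg_left hkx (le_max_right _ _)) he0
  have hxx : x * x = (n : ℝ) ^ (s + s) := by rw [hx, ← Real.rpow_add hnpos]
  calc μ.real (kissV n 0 1) ≤ x * (max C₁ 0 * (2 * x) * (exactDens n).toReal) :=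
        h1.trans (mul_le_mul_of_nonneg_left h2 hx0.le)
    _ = 2 * max C₁ 0 * (x * x) * (exactDens n).toReal := by ring
    _ = 2 * max C₁ 0 * (n : ℝ) ^ (s + s) * (exactDens n).toReal := by rw [hxx]

/-- **The direct step** (the content of `stub_directStep`, hypotheses in the local vocabulary): the truncated
census, the tall-density bound and KTail give `AprioriV (3 - σ)` for every `σ > 0`. -/
theorem aprioriV_direct
    (hCensus : ∃ C : ℝ, ∀ n k : ℕ, 1 ≤ n → 1 ≤ k →
      μ.real (kissV n 0 1 ∩ {ω | (partnerKiss n ω).ncard ≤ k}) ≤ C * (k : ℝ) * (exactDens n).toReal)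
    (hTall : ∀ s : ℝ, 0 < s → ∃ C : ℝ, ∀ n : ℕ, 1 ≤ n → tallDens n ≤ ENNReal.ofReal (C * (n : ℝ) ^ (s - 2)))
    (hK : ∀ s : ℝ, 0 < s → ∀ᶠ n : ℕ in Filter.atTop,
      (n : ℝ) ^ (-s) * μ.real (kissV n 0 1) ≤
        μ.real (kissV n 0 1 ∩ {ω | (partnerKiss n ω).ncard ≤ ⌈(n : ℝ) ^ s⌉₊}))
    {σ : ℝ} (hσ : 0 < σ) :
    ∃ C : ℝ, ∀ n : ℕ, 1 ≤ n → μ.real (kissV n 0 1) ≤ C * (n : ℝ) ^ (-(3 - σ)) := by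
  obtain ⟨C₁, hC₁⟩ := hCensus
  have hσ3 : 0 < σ / 3 := by positivity
  obtain ⟨Ct, hCt⟩ := hTall (σ / 3) hσ3
  obtain ⟨N₀, hN₀⟩ := Filter.eventually_atTop.1 (hK (σ / 3) hσ3)
  obtain ⟨γ, hγ⟩ : ∃ γ : ℝ, γ = σ / 3 + σ / 3 := ⟨_, rfl⟩
  have hγ0 : 0 ≤ γ := by rw [hγ]; positivity
  have hC₂0 : (0 : ℝ) ≤ 2 * max C₁ 0 := mul_nonneg zero_le_two (le_max_right _ _)
  -- the bound at every `n ≥ max N₀ 1`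
  have hstep : ∀ n : ℕ, max N₀ 1 ≤ n →
      μ.real (kissV n 0 1) ≤ 2 * max C₁ 0 * (n : ℝ) ^ γ * (exactDens n).toReal := by
    intro n hn
    rw [hγ]
    exact pointwise (le_of_max_le_right hn) hσ3.le (fun k hk => hC₁ n k (le_of_max_le_right hn) hk)
      (hN₀ n (le_of_max_le_left hn))
  -- dyadic averaging
  have hanti : ∀ m m' : ℕ, m ≤ m' → μ.real (kissV m' 0 1) ≤ μ.real (kissV m 0 1) :=
    fun m m' h => measureReal_mono (kissV_antitone_level h 0 1)
  have hsum : ∀ N : ℕ, 1 ≤ N →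
      ∑ m ∈ Finset.Icc N (2 * N), (exactDens m).toReal ≤ max Ct 0 * (N : ℝ) ^ (σ / 3 - 2) :=
    fun N hN => sum_exactDens_toReal_le (hCt N hN)
  have heven : ∀ N : ℕ, max N₀ 1 ≤ N →
      μ.real (kissV (2 * N) 0 1) ≤ 2 * max C₁ 0 * (2 : ℝ) ^ γ * max Ct 0 * (N : ℝ) ^ (-(3 - σ)) := by
    intro N hN
    have hN1 : 1 ≤ N := le_of_max_le_right hN
    have h := even_bound (f := fun m => μ.real (kissV m 0 1)) (e := fun m => (exactDens m).toReal)
      hγ0 hC₂0 (le_max_right Ct 0) (fun _ => ENNReal.toReal_nonneg) hanti hstep (hsum N hN1) hN hN1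
    have hexp : γ + σ / 3 - 3 = -(3 - σ) := by rw [hγ]; ring
    rw [hexp] at h
    exact h
  exact decay_of_eventually (f := fun m => μ.real (kissV m 0 1)) (le_max_right N₀ 1)
    (fun _ => measureReal_le_one) hanti heven

end StubDirectStep

open StubDirectStep in
/-- **Registered stub `stub_directStep`** of the skeleton `Cruxes/BoundaryTwoArmDecay/Lines/staircase_bootstrap_floor_decoupling.lean`
(line `staircase-bootstrap-floor-decoupling`, reshaped by lead c1) — the DIRECT STEP
`SubpolynomialBlocking → KTail → ∀ σ > 0, AprioriV (3 - σ)`: KTail at loss `σ/3`, the landed truncated census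
(`stub_census`) with `k = ⌈n^{σ/3}⌉`, the landed tall density (`stub_tallDensity`, from stmt-4446) at `t = σ/3`, dyadic
averaging and the passage from even scales to all `n ≥ 1`.  Proof: `StubDirectStep.aprioriV_direct`. -/
theorem stub_directStep :
    Summit.CriticalPhenomena.PercolationContinuityZ3.Theses.PercNonProliferation.SubpolynomialBlocking →
    (∀ s : ℝ, 0 < s → ∀ᶠ n : ℕ in Filter.atTop,
      (n : ℝ) ^ (-s) *
          (bondPercolation (zdGraph 3) (criticalProbI 3)).real
            {ω | (∃ y : Site 3, (n : ℤ) ≤ y 0 ∧ ω ∈ openConnIn (halfSpace 3) 0 y) ∧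
              (∃ y : Site 3, (n : ℤ) ≤ y 0 ∧ ω ∈ openConnIn (halfSpace 3) ((0 : Site 3) + Pi.single 1 1) y) ∧
              ω ∉ openConnIn (halfSpace 3) 0 ((0 : Site 3) + Pi.single 1 1)} ≤
        (bondPercolation (zdGraph 3) (criticalProbI 3)).real
          ({ω | (∃ y : Site 3, (n : ℤ) ≤ y 0 ∧ ω ∈ openConnIn (halfSpace 3) 0 y) ∧
              (∃ y : Site 3, (n : ℤ) ≤ y 0 ∧ ω ∈ openConnIn (halfSpace 3) ((0 : Site 3) + Pi.single 1 1) y) ∧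
              ω ∉ openConnIn (halfSpace 3) 0 ((0 : Site 3) + Pi.single 1 1)} ∩
            {ω | {q : Site 3 × Site 3 | q.1 0 = 0 ∧ q.2 0 = 0 ∧ (zdGraph 3).Adj q.1 q.2 ∧
                ω ∈ openConnIn (halfSpace 3) 0 q.1 ∧ ω ∉ openConnIn (halfSpace 3) 0 q.2 ∧
                ∃ y : Site 3, (n : ℤ) ≤ y 0 ∧ ω ∈ openConnIn (halfSpace 3) q.2 y}.ncard ≤ ⌈(n : ℝ) ^ s⌉₊})) →
    ∀ σ : ℝ, 0 < σ → ∃ C : ℝ, ∀ n : ℕ, 1 ≤ n →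
      (bondPercolation (zdGraph 3) (criticalProbI 3)).real
          {ω | (∃ y : Site 3, (n : ℤ) ≤ y 0 ∧ ω ∈ openConnIn (halfSpace 3) 0 y) ∧
            (∃ y : Site 3, (n : ℤ) ≤ y 0 ∧ ω ∈ openConnIn (halfSpace 3) ((0 : Site 3) + Pi.single 1 1) y) ∧
            ω ∉ openConnIn (halfSpace 3) 0 ((0 : Site 3) + Pi.single 1 1)} ≤ C * (n : ℝ) ^ (-(3 - σ)) :=
  fun hB hK _σ hσ => aprioriV_direct stub_census (stub_tallDensity hB) hK hσ

open StubDirectStep StubStep Negative in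
/-- **Conditional reduction of crux A to KTail** (registered sub-goal `stub_kTailReduction` of stmt-CriticalPhenomena-0911,
line `staircase-bootstrap-floor-decoupling` as reshaped by lead c1): KTail, a polynomial slab crossover with exponent
`A ∈ [1, 6/5)` (stmt-6700 strengthened: the registered stub `stub_slab`) and the tagged sibling crux `SubpolynomialBlocking`
(stmt-4446) imply `BoundaryTwoArmDecay`.  Proof: the direct step (`StubDirectStep.aprioriV_direct`, fed by the landed
`stub_census` and `stub_tallDensity`) at loss `3σ`, `σ = (6 - 5A)/16`, then the landed `stub_reach` with `b = 13/4 - 5A/8`,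
`κ = b - 5/2`. -/
theorem stub_kTailReduction :
    (∀ s : ℝ, 0 < s → ∀ᶠ n : ℕ in Filter.atTop,
      (n : ℝ) ^ (-s) *
          (bondPercolation (zdGraph 3) (criticalProbI 3)).real
            {ω | (∃ y : Site 3, (n : ℤ) ≤ y 0 ∧ ω ∈ openConnIn (halfSpace 3) 0 y) ∧
              (∃ y : Site 3, (n : ℤ) ≤ y 0 ∧ ω ∈ openConnIn (halfSpace 3) ((0 : Site 3) + Pi.single 1 1) y) ∧
              ω ∉ openConnIn (halfSpace 3) 0 ((0 : Site 3) + Pi.single 1 1)} ≤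
        (bondPercolation (zdGraph 3) (criticalProbI 3)).real
          ({ω | (∃ y : Site 3, (n : ℤ) ≤ y 0 ∧ ω ∈ openConnIn (halfSpace 3) 0 y) ∧
              (∃ y : Site 3, (n : ℤ) ≤ y 0 ∧ ω ∈ openConnIn (halfSpace 3) ((0 : Site 3) + Pi.single 1 1) y) ∧
              ω ∉ openConnIn (halfSpace 3) 0 ((0 : Site 3) + Pi.single 1 1)} ∩
            {ω | {q : Site 3 × Site 3 | q.1 0 = 0 ∧ q.2 0 = 0 ∧ (zdGraph 3).Adj q.1 q.2 ∧
                ω ∈ openConnIn (halfSpace 3) 0 q.1 ∧ ω ∉ openConnIn (halfSpace 3) 0 q.2 ∧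
                ∃ y : Site 3, (n : ℤ) ≤ y 0 ∧ ω ∈ openConnIn (halfSpace 3) q.2 y}.ncard ≤ ⌈(n : ℝ) ^ s⌉₊})) →
    (∃ A : ℝ, 1 ≤ A ∧ A < 6 / 5 ∧ ∃ C : ℝ, 0 < C ∧ ∀ k n : ℕ, 1 ≤ k → ∀ x : Site 3,
      (bondPercolation (zdGraph 3) (criticalProbI 3)).real
          {ω | ∃ y : Site 3, (n : ℤ) ≤ max |y 1 - x 1| |y 2 - x 2| ∧
            ω ∈ openConnIn {z : Site 3 | |z 0| ≤ (k : ℤ)} x y} ≤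
        C * (k : ℝ) ^ C * Real.exp (-((n : ℝ) / (C * (k : ℝ) ^ A)))) →
    Summit.CriticalPhenomena.PercolationContinuityZ3.Theses.PercNonProliferation.SubpolynomialBlocking →
      Summit.CriticalPhenomena.PercolationContinuityZ3.Theses.PercLowPointHalfSpace.BoundaryTwoArmDecay := by
  intro hK hSlab hB
  -- the slab exponent A ∈ [1, 6/5) fixes the losses
  obtain ⟨A, hA1, hA65, hSlabA⟩ := hSlab
  set σ : ℝ := (6 - 5 * A) / 16 with hσdef
  have hσ : 0 < σ := by rw [hσdef]; linarith
  -- the direct step at loss 3σ: vertical exponent 3 - 3σ, from the landed census and tall density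
  have hV : ∃ C : ℝ, ∀ n : ℕ, 1 ≤ n → μ.real (kissV n 0 1) ≤ C * (n : ℝ) ^ (-(3 - 3 * σ)) :=
    aprioriV_direct stub_census (stub_tallDensity hB) hK (by positivity : (0 : ℝ) < 3 * σ)
  -- reach: sup exponent b = 13/4 - 5A/8 > 5/2, admissible since bA < 3 - 3σ ⟺ (6/5 - A)(5/2 - A) > 0
  set b : ℝ := 13 / 4 - 5 * A / 8 with hbdef
  have hb52 : (5 : ℝ) / 2 < b := by rw [hbdef]; linarith
  have hb : 0 < b := by linarith
  have hbA : b * A < 3 - 3 * σ := by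
    rw [hbdef, hσdef]
    nlinarith [mul_pos (sub_pos.2 hA65) (sub_pos.2 (show A < 5 / 2 by linarith))]
  obtain ⟨C, hC⟩ := stub_reach A hA1 hSlabA (3 - 3 * σ) b hb hbA hV
  -- κ = b - 5/2
  rw [boundaryTwoArmDecay_iff]
  refine ⟨b - 5 / 2, C, by linarith, fun r hr => ?_⟩
  have hexp : (-(5 / 2 + (b - 5 / 2)) : ℝ) = -b := by ring
  rw [hexp]
  exact hC r hr

end Summit.CriticalPhenomena.PercolationContinuityZ3.Theorems.BoundaryTwoArmDecay

end
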